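import Summits.Parity.BatemanHorn.Theorems.AlmostPrimeZerosSystemLSDRealSegmentNairEuler
import HarnessLib

/-!
# Nair–Tenenbaum light, V: Rankin's trick with a uniform exponent and the Mertens window

Crux `SystemLSDRealSegment` (stmt-Parity-11292, route `AlmostPrimeZeros`), line `beta-thinned-root-kernel`,
support programme of the lead c8: **Nair–Tenenbaum "light"** — the sharp-order upper bound
`Σ_{1≤n≤N} G(F(n)) ≤ C · N · exp(Σ_{p≤N} (G(p) − 1) ρ_F(p)/p)` for a polynomial `F ∈ ℤ[X]` (degree `≥ 1`, positive on
`ℕ_{≥1}`, root counts `ρ_F(p) ≤ D`, `ρ_F(p) < p`, `ρ_F(p^a) ≤ M`) and every weight `G ≥ 0`, `G(1) = 1`, multiplicative on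
coprime arguments with `G(p^v) ≤ A` (M. Nair, Acta Arith. 62 (1992); Nair–Tenenbaum, Acta Math. 180 (1998), Thm 1 —
the special case of the class bounded at prime powers), by Shiu's method (J. reine angew. Math. 313 (1980), §5) run on the
values `m = F(n)`: cut `m = c·d` at `√N` (`Shiu.cutPrime/cPart/dPart`), four classes, the beta upper-bound sieve of dimension
`2D` on the root classes of `c`, Hall–Tenenbaum's Theorem 01 and Rankin's trick with a uniform exponent for the `c`-sums.
Applied (file `…NairUpperBound`) to the product polynomial of a Bateman–Horn system with `G = y^{capped}` it gives
`Σ_{n≤x} y^{s_f(n)} ≪ x (log x)^{k(y−1)}`, i.e. `H_x(y) = O(1)` on the real segment — the upper half of the order of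
magnitude predicted by the crux (lower half: `sumPowStat_lower_bound`, landed).  Everything here is PROVED; no definitions.

This file: `rankin_u` (Shiu's Lemma 3 for `u`, uniformly over the weight class), `rankin_rho_smooth` (class III), `densityProd_le` (`V(w) ≤ K (log N/log w)^D e^{−Σ_{p≤N}ρ(p)/p}`).
-/

open Finset Real Polynomial

namespace Summit.Parity.BatemanHorn.Cruxes.SystemLSDRealSegment.BetaThinnedRootKernel.Nair

open Literature.NumberTheory.Sieve

noncomputable section

section Euler

variable (F : ℤ[X]) {D M : ℕ} {G : ℕ → ℝ} {A : ℝ}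

/-- **Rankin's trick with a uniform exponent** (Shiu's Lemma 3 for `u = G·ρ·h`): for `2 ≤ v`, `0 < η ≤ 1/3`,
`0 < Y` and a finite set `S` of integers `c > Y` all of whose prime factors are `< v`,
`Σ_{c ∈ S} u(c)/c ≤ Y^{−η} exp(K + A D (4D+2) η v^η (log v + log 4) + Σ_{p < v} G(p)ρ(p)/p)`
with `K = K(A, M, D)`. [folklore] -/
theorem rankin_u (hD : ∀ p : ℕ, p.Prime → polyRootCountMod ![F] p ≤ D) (hD1 : 1 ≤ D)
    (hfix : ∀ p : ℕ, p.Prime → polyRootCountMod ![F] p < p)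
    (hM : ∀ p : ℕ, p.Prime → ∀ a : ℕ, 1 ≤ a → polyRootCountMod ![F] (p ^ a) ≤ M) (hM1 : 1 ≤ M)
    (hA : 1 ≤ A) :
    ∃ K : ℝ, ∀ G : ℕ → ℝ, (∀ n, 0 ≤ G n) → G 1 = 1 → (∀ m n : ℕ, m.Coprime n → G (m * n) = G m * G n) →
      (∀ p : ℕ, p.Prime → ∀ v : ℕ, 1 ≤ v → G (p ^ v) ≤ A) →
      ∀ (v : ℝ), 2 ≤ v → ∀ η : ℝ, 0 < η → η ≤ 1 / 3 → ∀ Y : ℝ, 0 < Y →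
      ∀ S : Finset ℕ, (∀ c ∈ S, c ≠ 0 ∧ Y < (c : ℝ) ∧ ∀ p ∈ c.primeFactors, (p : ℝ) < v) →
        ∑ c ∈ S, G c * polyRootCountMod ![F] c *
            (∏ p ∈ c.primeFactors, (p : ℝ) / ((p : ℝ) - polyRootCountMod ![F] p)) / c ≤
          Y ^ (-η) * Real.exp (K + A * D * (4 * D + 2) * η * v ^ η * (Real.log v + Real.log 4) +
            ∑ p ∈ Nat.primesBelow ⌈v⌉₊, G p * polyRootCountMod ![F] p / p) := by
  have _hD1 := hD1
  have _hM1 := hM1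
  set W : ℝ := A * M * (4 * D + 2) with hW
  set S₁ : ℝ := ∑' n : ℕ, (n : ℝ) ^ (-(4 / 3 : ℝ)) with hS₁
  refine ⟨4 * W * S₁ + A * (4 * D + 2) * D ^ 2, fun G hG0 hG1 hGmul hGA v hv η hη0 hη Y hY S hS => ?_⟩
  set u : ℕ → ℝ := fun c => G c * polyRootCountMod ![F] c *
    ∏ p ∈ c.primeFactors, (p : ℝ) / ((p : ℝ) - polyRootCountMod ![F] p) with hu
  have hu' : ∀ c, u c = G c * polyRootCountMod ![F] c *
      ∏ p ∈ c.primeFactors, (p : ℝ) / ((p : ℝ) - polyRootCountMod ![F] p) := fun c => rfl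
  obtain ⟨hu1, hu0, humul, hupow, hup, -⟩ := u_props F hD hfix hM hG0 hG1 hGmul hGA hA hu'
  have hA0 : 0 < A := by linarith
  have hD0 : (0 : ℝ) ≤ D := Nat.cast_nonneg D
  have hW0 : 0 ≤ W := by positivity
  set N := ⌈v⌉₊ with hN
  have hSm : ∀ k ∈ S, k ∈ Nat.smoothNumbers N := by
    intro k hk
    obtain ⟨hk0, -, hkv⟩ := hS k hk
    rw [Nat.mem_smoothNumbers']
    intro p hp hpk
    have : (p : ℝ) < v := hkv p (Nat.mem_primeFactors.2 ⟨hp, hpk, hk0⟩)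
    exact Nat.lt_ceil.2 this
  have humul' : ∀ {m n : ℕ}, Nat.Coprime m n → u (m * n) = u m * u n := fun {m n} h => humul m n h
  have hupow' : ∀ p a : ℕ, p.Prime → 1 ≤ a → u (p ^ a) ≤ W := fun p a hp ha => hupow p hp a ha
  have h := sum_div_le_rankin hu0 hu1 humul' hW0 hupow' N hη0.le hη hY hSm
  rw [Finset.filter_true_of_mem (fun k hk => (hS k hk).2.1)] at h
  show ∑ c ∈ S, u c / c ≤ _
  refine h.trans (mul_le_mul_of_nonneg_left (Real.exp_le_exp.2 ?_) (by positivity))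
  have hs : ∀ p ∈ Nat.primesBelow N, p.Prime := fun p hp => Nat.prime_of_mem_primesBelow hp
  have hsv : ∀ p ∈ Nat.primesBelow N, (p : ℝ) ≤ v := fun p hp =>
    (Nat.lt_ceil.1 (Nat.lt_of_mem_primesBelow hp)).le
  have hB0 : 0 ≤ A * D * (4 * D + 2) := by positivity
  have h1 := Shiu.sum_rpow_le_sum_div_add (f := u) hs (by linarith : (1 : ℝ) ≤ v) hsv hB0
    (fun p hp => hup p (hs p hp)) hη0.le
  have h2 := sum_u_prime_div_le F hD hfix hM hG0 hG1 hGmul hGA hA hu' hs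
  have h3 : ∑ p ∈ Nat.primesBelow N, 4 * W * (p : ℝ) ^ (2 * η - 2) ≤ 4 * W * S₁ := by
    rw [← Finset.mul_sum]
    refine mul_le_mul_of_nonneg_left ?_ (by positivity)
    calc ∑ p ∈ Nat.primesBelow N, (p : ℝ) ^ (2 * η - 2)
        ≤ ∑ p ∈ Nat.primesBelow N, (p : ℝ) ^ (-(4 / 3 : ℝ)) :=
          Finset.sum_le_sum fun p hp =>
            Real.rpow_le_rpow_of_exponent_le (by exact_mod_cast (hs p hp).one_lt.le) (by linarith)
      _ ≤ S₁ := Summable.sum_le_tsum _ (fun n _ => by positivity) (Real.summable_nat_rpow.2 (by norm_num))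
  rw [Finset.sum_add_distrib]
  linarith [h1, h2, h3]

/-- **Rankin for the smooth count** (Shiu's class III): for `2 ≤ L`, `0 < Y` and a finite set `S` of integers
`c > Y` with all prime factors `< L`, `Σ_{c ∈ S} ρ(c)/c ≤ Y^{−1/3} exp((M + 4M) L)`. [folklore] -/
theorem rankin_rho_smooth (hM : ∀ p : ℕ, p.Prime → ∀ a : ℕ, 1 ≤ a → polyRootCountMod ![F] (p ^ a) ≤ M)
    (hM1 : 1 ≤ M) {L : ℝ} (hL : 2 ≤ L) {Y : ℝ} (hY : 0 < Y) (S : Finset ℕ)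
    (hS : ∀ c ∈ S, c ≠ 0 ∧ Y < (c : ℝ) ∧ ∀ p ∈ c.primeFactors, (p : ℝ) < L) :
    ∑ c ∈ S, (polyRootCountMod ![F] c : ℝ) / c ≤ Y ^ (-(1 / 3 : ℝ)) * Real.exp (5 * M * L) := by
  have _hM1 := hM1
  set ρ : ℕ → ℝ := fun m => (polyRootCountMod ![F] m : ℝ) with hρ
  have hρ1' : polyRootCountMod ![F] 1 = 1 := by rw [polyRootCountMod_single]; simp
  have hg0 : ∀ k, 0 ≤ ρ k := fun k => Nat.cast_nonneg _
  have hg1 : ρ 1 = 1 := by simp [hρ, hρ1']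
  have hmul : ∀ {m n : ℕ}, Nat.Coprime m n → ρ (m * n) = ρ m * ρ n := by
    intro m n hmn
    simp only [hρ, polyRootCountMod_mul_of_coprime F hmn, Nat.cast_mul]
  have hM0 : (0 : ℝ) ≤ M := Nat.cast_nonneg M
  have hgW : ∀ p a : ℕ, p.Prime → 1 ≤ a → ρ (p ^ a) ≤ M := fun p a hp ha => by
    simp only [hρ]
    exact_mod_cast hM p hp a ha
  set N := ⌈L⌉₊ with hN
  have hSm : ∀ k ∈ S, k ∈ Nat.smoothNumbers N := by
    intro k hk
    obtain ⟨hk0, -, hkL⟩ := hS k hk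
    rw [Nat.mem_smoothNumbers']
    intro p hp hpk
    have : (p : ℝ) < L := hkL p (Nat.mem_primeFactors.2 ⟨hp, hpk, hk0⟩)
    exact Nat.lt_ceil.2 this
  have h := sum_div_le_rankin hg0 hg1 hmul hM0 hgW N (by norm_num : (0 : ℝ) ≤ 1 / 3) le_rfl hY hSm
  rw [Finset.filter_true_of_mem (fun k hk => (hS k hk).2.1)] at h
  show ∑ c ∈ S, ρ c / c ≤ _
  refine h.trans (mul_le_mul_of_nonneg_left (Real.exp_le_exp.2 ?_) (by positivity))
  have hterm : ∀ p ∈ Nat.primesBelow N,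
      ρ p * (p : ℝ) ^ ((1 / 3 : ℝ) - 1) + 4 * M * (p : ℝ) ^ (2 * (1 / 3 : ℝ) - 2) ≤ 5 * M := by
    intro p hp
    have hpp := Nat.prime_of_mem_primesBelow hp
    have hp1 : (1 : ℝ) ≤ p := by exact_mod_cast hpp.one_lt.le
    have e1 : (p : ℝ) ^ ((1 / 3 : ℝ) - 1) ≤ 1 := Real.rpow_le_one_of_one_le_of_nonpos hp1 (by norm_num)
    have e2 : (p : ℝ) ^ (2 * (1 / 3 : ℝ) - 2) ≤ 1 :=
      Real.rpow_le_one_of_one_le_of_nonpos hp1 (by norm_num)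
    have e3 : ρ p ≤ M := by
      have := hgW p 1 hpp le_rfl
      rwa [pow_one] at this
    have e4 : 0 ≤ (p : ℝ) ^ ((1 / 3 : ℝ) - 1) := by positivity
    have e5 : 0 ≤ (p : ℝ) ^ (2 * (1 / 3 : ℝ) - 2) := by positivity
    have e6 := hg0 p
    nlinarith
  have hcard : (#(Nat.primesBelow N) : ℝ) ≤ L := by
    have h1 : #(Nat.primesBelow N) ≤ N - 2 := by
      rw [Nat.primesBelow_eq_filter_Ico_two]
      exact (Finset.card_filter_le _ _).trans (by simp)
    have hN2 : 2 ≤ N := Nat.lt_ceil.2 (by push_cast; linarith)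
    have hNlt : (N : ℝ) < L + 1 := Nat.ceil_lt_add_one (by linarith)
    have e : ((N - 2 : ℕ) : ℝ) = (N : ℝ) - 2 := by push_cast [Nat.cast_sub hN2]; ring
    calc (#(Nat.primesBelow N) : ℝ) ≤ ((N - 2 : ℕ) : ℝ) := by exact_mod_cast h1
      _ ≤ L := by rw [e]; linarith
  calc ∑ p ∈ Nat.primesBelow N, (ρ p * (p : ℝ) ^ ((1 / 3 : ℝ) - 1) + 4 * M * (p : ℝ) ^ (2 * (1 / 3 : ℝ) - 2))
      ≤ ∑ p ∈ Nat.primesBelow N, (5 * M : ℝ) := Finset.sum_le_sum hterm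
    _ = 5 * M * #(Nat.primesBelow N) := by rw [Finset.sum_const, nsmul_eq_mul]; ring
    _ ≤ 5 * M * L := mul_le_mul_of_nonneg_left hcard (by positivity)

/-- **The Mertens window for `V`.** `∏_{p<w} (1 − ρ(p)/p) ≤ K (log N/log w)^D exp(−Σ_{p ≤ N} ρ(p)/p)` for
`2 ≤ w ≤ N`, `K = K(D)`. [folklore] -/
theorem densityProd_le (hD : ∀ p : ℕ, p.Prime → polyRootCountMod ![F] p ≤ D)
    (hfix : ∀ p : ℕ, p.Prime → polyRootCountMod ![F] p < p) :
    ∃ K : ℝ, 0 < K ∧ ∀ (N : ℕ) (w : ℝ), 2 ≤ w → w ≤ N →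
      ∏ p ∈ Nat.primesBelow ⌈w⌉₊, (1 - (polyRootCountMod ![F] p : ℝ) / p) ≤
        K * (Real.log N / Real.log w) ^ D * Real.exp (-∑ p ∈ Nat.primesLE N, (polyRootCountMod ![F] p : ℝ) / p) := by
  refine ⟨Real.exp (25 * D), Real.exp_pos _, fun N w hw hwN => ?_⟩
  set ρ : ℕ → ℝ := fun m => (polyRootCountMod ![F] m : ℝ) with hρ
  set s := Nat.primesBelow ⌈w⌉₊ with hs
  set T := Nat.primesLE N with hT
  have hN2 : (2 : ℝ) ≤ N := hw.trans hwN
  have hD0 : (0 : ℝ) ≤ D := Nat.cast_nonneg D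
  have hsub : s ⊆ T := by
    intro p hp
    rw [hs, Nat.mem_primesBelow] at hp
    rw [hT, Nat.mem_primesLE]
    refine ⟨?_, hp.2⟩
    have : (p : ℝ) < w := Nat.lt_ceil.1 hp.1
    exact_mod_cast this.le.trans hwN
  -- Step 1: `∏ (1 - ρ(p)/p) ≤ exp (-∑ ρ(p)/p)`
  have h1 : ∏ p ∈ s, (1 - ρ p / p) ≤ Real.exp (∑ p ∈ s, (-(ρ p / p))) := by
    refine prod_le_exp_sum s (fun p hp => ?_) (fun p _ => by linarith)
    have hpp := Nat.prime_of_mem_primesBelow hp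
    have hp0 : (0 : ℝ) < p := by exact_mod_cast hpp.pos
    have : ρ p < p := by
      simp only [hρ]
      exact_mod_cast hfix p hpp
    rw [sub_nonneg, div_le_one hp0]
    exact this.le
  -- Step 2: members of `T \ s` are primes `p ≤ N` with `w ≤ p`
  have hmem : ∀ p ∈ T \ s, p.Prime ∧ p ≤ N ∧ w ≤ (p : ℝ) := by
    intro p hp
    rw [Finset.mem_sdiff, hT, Nat.mem_primesLE, hs, Nat.mem_primesBelow] at hp
    refine ⟨hp.1.2, hp.1.1, ?_⟩
    by_contra hlt
    exact hp.2 ⟨Nat.lt_ceil.2 (not_le.1 hlt), hp.1.2⟩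
  -- Step 3: the Mertens tail
  have key : ∑ p ∈ T \ s, (p : ℝ)⁻¹ ≤ Real.log (Real.log N) - Real.log (Real.log w) + 25 := by
    have hlog2 : (0.6931471803 : ℝ) < Real.log 2 := Real.log_two_gt_d9
    by_cases hw4 : 4 ≤ w
    · have hX : (2 : ℝ) ≤ w / 2 := by linarith
      have hXy : w / 2 ≤ (N : ℝ) := by linarith
      have h := sum_inv_primes_Ioc_le hX hXy
      rw [Nat.floor_natCast] at h
      have hsub2 : T \ s ⊆ (Nat.primesLE N).filter (fun p : ℕ => w / 2 < (p : ℝ)) := by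
        intro p hp
        obtain ⟨hpp, hpN, hwp⟩ := hmem p hp
        exact Finset.mem_filter.2 ⟨Nat.mem_primesLE.2 ⟨hpN, hpp⟩, by linarith⟩
      have h2 : ∑ p ∈ T \ s, (p : ℝ)⁻¹ ≤
          ∑ p ∈ (Nat.primesLE N).filter (fun p : ℕ => w / 2 < (p : ℝ)), (p : ℝ)⁻¹ :=
        Finset.sum_le_sum_of_subset_of_nonneg hsub2 fun p _ _ => inv_nonneg.2 (Nat.cast_nonneg p)
      have hlogw : Real.log 4 ≤ Real.log w := Real.log_le_log (by norm_num) hw4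
      have hlog4 : Real.log 4 = 2 * Real.log 2 := by
        rw [show (4 : ℝ) = 2 ^ 2 by norm_num, Real.log_pow]
        push_cast
        ring
      have hlogw2 : Real.log (w / 2) = Real.log w - Real.log 2 :=
        Real.log_div (by linarith) (by norm_num)
      have hlogwpos : 0 < Real.log w := by linarith
      have hhalf : Real.log w / 2 ≤ Real.log (w / 2) := by
        rw [hlogw2]
        linarith
      have h3 : Real.log (Real.log w) - Real.log 2 ≤ Real.log (Real.log (w / 2)) := by
        rw [← Real.log_div hlogwpos.ne' (by norm_num)]
        exact Real.log_le_log (by positivity) hhalf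
      have h4 : 16 / Real.log (w / 2) ≤ 16 / Real.log 2 :=
        div_le_div_of_nonneg_left (by norm_num) (by linarith) (Real.log_le_log (by norm_num) hX)
      have h5 : 16 / Real.log 2 ≤ 24 := by
        rw [div_le_iff₀ (by linarith)]
        linarith
      have hlog2' : Real.log 2 < 1 := by
        have := Real.log_two_lt_d9
        linarith
      linarith
    · have hw4 : w < 4 := not_le.1 hw4
      have hN2' : 2 ≤ N := by exact_mod_cast hN2
      have h := Literature.NumberTheory.LFunctions.MertensBound.sum_inv_prime_le N hN2'
      have h2 : ∑ p ∈ T \ s, (p : ℝ)⁻¹ ≤ ∑ p ∈ T, (p : ℝ)⁻¹ :=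
        Finset.sum_le_sum_of_subset_of_nonneg Finset.sdiff_subset
          fun p _ _ => inv_nonneg.2 (Nat.cast_nonneg p)
      have h3 : ∑ p ∈ T, (p : ℝ)⁻¹ = ∑ p ∈ Nat.primesLE N, 1 / (p : ℝ) := by
        simp only [hT, one_div]
      have hlogw : Real.log w < 3 := by
        have := Real.log_le_sub_one_of_pos (show (0 : ℝ) < w by linarith)
        linarith
      have hlogwpos : 0 < Real.log w := Real.log_pos (by linarith)
      have h4 : Real.log (Real.log w) ≤ 2 := by
        have := Real.log_le_sub_one_of_pos hlogwpos
        linarith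
      linarith
  have htail : ∑ p ∈ T \ s, ρ p / p ≤
      D * (Real.log (Real.log N) - Real.log (Real.log w)) + 25 * D := by
    have hle1 : ∑ p ∈ T \ s, ρ p / p ≤ D * ∑ p ∈ T \ s, (p : ℝ)⁻¹ := by
      rw [Finset.mul_sum]
      refine Finset.sum_le_sum fun p hp => ?_
      have hpp := (hmem p hp).1
      have hp0 : (0 : ℝ) < p := by exact_mod_cast hpp.pos
      rw [div_eq_mul_inv]
      refine mul_le_mul_of_nonneg_right ?_ (inv_nonneg.2 hp0.le)
      simp only [hρ]
      exact_mod_cast hD p hpp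
    calc ∑ p ∈ T \ s, ρ p / p ≤ D * ∑ p ∈ T \ s, (p : ℝ)⁻¹ := hle1
      _ ≤ D * (Real.log (Real.log N) - Real.log (Real.log w) + 25) := mul_le_mul_of_nonneg_left key hD0
      _ = _ := by ring
  -- assemble
  have hsplit : ∑ p ∈ s, (-(ρ p / p)) = -∑ p ∈ T, ρ p / p + ∑ p ∈ T \ s, ρ p / p := by
    rw [Finset.sum_neg_distrib, ← Finset.sum_sdiff hsub]
    ring
  calc ∏ p ∈ s, (1 - ρ p / p) ≤ Real.exp (∑ p ∈ s, (-(ρ p / p))) := h1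
    _ ≤ Real.exp (-∑ p ∈ T, ρ p / p +
          (D * (Real.log (Real.log N) - Real.log (Real.log w)) + 25 * D)) := by
        rw [hsplit, Real.exp_le_exp]
        linarith
    _ = Real.exp (25 * D) * (Real.log N / Real.log w) ^ D * Real.exp (-∑ p ∈ T, ρ p / p) := by
        rw [← exp_mul_loglog_sub_loglog (by linarith) hwN D, ← Real.exp_add, ← Real.exp_add]
        congr 1
        ring

end Euler

/-- **Registered form** (`--supports stmt-Parity-11292`): the Mertens window for `V(w)`; with `rankin_u`, `rankin_rho_smooth` in the same file. [folklore] -/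
theorem nair_densityProd_le : ∀ (F : ℤ[X]) (D : ℕ), (∀ p : ℕ, p.Prime → polyRootCountMod ![F] p ≤ D) → (∀ p : ℕ, p.Prime → polyRootCountMod ![F] p < p) → ∃ K : ℝ, 0 < K ∧ ∀ (N : ℕ) (w : ℝ), 2 ≤ w → w ≤ N → ∏ p ∈ Nat.primesBelow ⌈w⌉₊, (1 - (polyRootCountMod ![F] p : ℝ) / p) ≤ K * (Real.log N / Real.log w) ^ D * Real.exp (-∑ p ∈ Nat.primesLE N, (polyRootCountMod ![F] p : ℝ) / p) :=
  fun F _D hD hfix => densityProd_le F hD hfix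

end

end Summit.Parity.BatemanHorn.Cruxes.SystemLSDRealSegment.BetaThinnedRootKernel.Nair
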